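import Summits.AtomisticToContinuum.Crystallization.Theses.ThreeConeCertificate
import Summits.AtomisticToContinuum.Crystallization.Theorems.ThreeConeCertificateExactCertificateDesignKepler
import Summits.AtomisticToContinuum.Crystallization.Theorems.ThreeConeCertificateExactCertificateLocalToGlobal

/-!
# `ExactCertificate` (stmt-AtomisticToContinuum-11959): the content stub of line `Ideator5Sketch`
# (`robust-soft-flyspeck`) IS the crux — registered stub `stub_designIffCrux`

Line `Ideator5Sketch`, line lead a1.  The line's one open stub `stub_design` asks for a template `P₀`, a range
`ρ`, a constant `c`, a radial positive-type `f` dominated by `V_LJ` beyond `ρ`, and ZERO-SUM TRANSFERS `T(Q,x)`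
certifying the one-centre inequality `½·Σ'_{y ∈ Q∖x} g_f(|x−y|) + T(Q,x) ≥ −c` at every motif site of every
periodic `Q` for the designed core `g_f := (V_LJ − f)·1_{(0,ρ)}`, with `c + f 0/2 = −e_LJ(P₀)`.

* `transferDesign_iff_coreDesign`: with transfers unrestricted (the gate types no transfer radius or lattice
  equivariance) the one-centre clause is EQUIVALENT to the periodic core bound `∀ Q, e_LJ(P₀) + f 0/2 ≤ e_Q(g_f)`:
  `→` is the line's `stub_localToGlobal` (sum over the motif; landed), `←` takes the canonical transfer
  `T(Q,x) := e_Q(g_f) − ½·(site sum at x)`, whose motif sum vanishes by the definition of `e_Q`.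
* `stub_designIffCrux` (registered signature verbatim): hence `stub_design ↔ ExactCertificate`
  (`Design.coreDesign_iff_exactCertificate`, landed) — the line's content stub is the crux in normal form, and
  (`Design.stub_designForcesKeplerBound`) it carries route item 11961 `KeplerBound` ↔ 0627 (open).

All `[folklore]`.
-/

noncomputable section

namespace Summit.AtomisticToContinuum.Crystallization.Theorems.ThreeConeCertificateExactCertificate.Design

open Literature.MathematicalPhysics.StatisticalMechanics
open Summit.AtomisticToContinuum.Crystallization.Theses.ThreeConeCertificate
open scoped BigOperators

/-- **The canonical transfer has zero motif sum.**  For any potential `W` and periodic `Q`,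
`Σ_{x ∈ motif Q} (e_Q(W) − ½·Σ'_{y ∈ Q∖x} W(|x−y|)) = 0` — this is the definition
`e_Q(W) = (2·#motif)⁻¹ Σ_x Σ'_y W` read backwards (`#motif ≥ 1`). [folklore] -/
theorem sum_canonicalTransfer_eq_zero (W : ℝ → ℝ) (Q : PeriodicConfiguration 3) :
    ∑ x ∈ Q.motif, (Q.energyPerParticle W -
      (2 : ℝ)⁻¹ * ∑' y : {y : EuclideanSpace ℝ (Fin 3) // y ∈ Q.points ∧ y ≠ x}, W (dist x y.1)) = 0 := by
  have hF : (0 : ℝ) < Q.motif.card := by exact_mod_cast Finset.card_pos.2 Q.motif_nonempty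
  rw [Finset.sum_sub_distrib, Finset.sum_const, nsmul_eq_mul, ← Finset.mul_sum]
  unfold PeriodicConfiguration.energyPerParticle
  field_simp
  ring

/-- **Transfer design ↔ core design.**  With unrestricted zero-sum transfers, "one-centre inequality for
`g_f` at every site of every periodic configuration, constant `c`, value identity `c + f 0/2 = −e_LJ(P₀)`" is
equivalent to the periodic core bound `∀ Q, e_LJ(P₀) + f 0/2 ≤ e_Q(g_f)` of the composition target:
`→` by `stub_localToGlobal`, `←` with the canonical transfer `T(Q,x) := e_Q(g_f) − ½·(site sum at x)` and
`c := −(e_LJ(P₀) + f 0/2)`. [folklore] -/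
theorem transferDesign_iff_coreDesign :
    (∃ (P₀ : PeriodicConfiguration 3) (ρ c : ℝ) (f : ℝ → ℝ)
        (T : PeriodicConfiguration 3 → EuclideanSpace ℝ (Fin 3) → ℝ),
      (∀ (n : ℕ) (y : Fin n → EuclideanSpace ℝ (Fin 3)) (w : Fin n → ℝ),
        0 ≤ ∑ i, ∑ j, w i * w j * f (dist (y i) (y j))) ∧
      (∀ r : ℝ, ρ ≤ r → 0 < r → f r ≤ lennardJones r) ∧
      (∀ Q : PeriodicConfiguration 3, ∑ x ∈ Q.motif, T Q x = 0) ∧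
      (∀ (Q : PeriodicConfiguration 3) (x : EuclideanSpace ℝ (Fin 3)), x ∈ Q.motif →
        -c ≤ (2 : ℝ)⁻¹ *
          (∑' y : {y : EuclideanSpace ℝ (Fin 3) // y ∈ Q.points ∧ y ≠ x},
            (fun r => if r < ρ then lennardJones r - f r else 0) (dist x y.1)) + T Q x) ∧
      c + f 0 / 2 = -(P₀.energyPerParticle lennardJones)) ↔
    ∃ (P₀ : PeriodicConfiguration 3) (ρ : ℝ) (f : ℝ → ℝ),
      (∀ (n : ℕ) (y : Fin n → EuclideanSpace ℝ (Fin 3)) (w : Fin n → ℝ),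
        0 ≤ ∑ i, ∑ j, w i * w j * f (dist (y i) (y j))) ∧
      (∀ r : ℝ, ρ ≤ r → 0 < r → f r ≤ lennardJones r) ∧
      ∀ Q : PeriodicConfiguration 3,
        P₀.energyPerParticle lennardJones + f 0 / 2 ≤
          Q.energyPerParticle (fun r => if r < ρ then lennardJones r - f r else 0) := by
  constructor
  · rintro ⟨P₀, ρ, c, f, T, hpd, htail, hzero, hloc, hval⟩
    refine ⟨P₀, ρ, f, hpd, htail, fun Q => ?_⟩
    have h := stub_localToGlobal (fun r => if r < ρ then lennardJones r - f r else 0) c T hzero hloc Q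
    linarith
  · rintro ⟨P₀, ρ, f, hpd, htail, hcore⟩
    refine ⟨P₀, ρ, -(P₀.energyPerParticle lennardJones + f 0 / 2), f,
      fun Q x => Q.energyPerParticle (fun r => if r < ρ then lennardJones r - f r else 0) -
        (2 : ℝ)⁻¹ * ∑' y : {y : EuclideanSpace ℝ (Fin 3) // y ∈ Q.points ∧ y ≠ x},
          (fun r => if r < ρ then lennardJones r - f r else 0) (dist x y.1),
      hpd, htail, fun Q => sum_canonicalTransfer_eq_zero _ Q, fun Q x _ => ?_, by ring⟩
    have h := hcore Q
    linarith

/-- **Registered stub `stub_designIffCrux` of crux item stmt-AtomisticToContinuum-11959 (line `Ideator5Sketch`;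
signature verbatim): the line's content stub `stub_design` is EQUIVALENT to the crux `ExactCertificate`**
(`transferDesign_iff_coreDesign` + `coreDesign_iff_exactCertificate`).  So the line reduces the crux to itself
in normal form; with `stub_designForcesKeplerBound` it carries route item 11961 `KeplerBound`. [folklore] -/
theorem stub_designIffCrux :
    (∃ (P₀ : PeriodicConfiguration 3) (ρ c : ℝ) (f : ℝ → ℝ)
        (T : PeriodicConfiguration 3 → EuclideanSpace ℝ (Fin 3) → ℝ),
      (∀ (n : ℕ) (y : Fin n → EuclideanSpace ℝ (Fin 3)) (w : Fin n → ℝ),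
        0 ≤ ∑ i, ∑ j, w i * w j * f (dist (y i) (y j))) ∧
      (∀ r : ℝ, ρ ≤ r → 0 < r → f r ≤ lennardJones r) ∧
      (∀ Q : PeriodicConfiguration 3, ∑ x ∈ Q.motif, T Q x = 0) ∧
      (∀ (Q : PeriodicConfiguration 3) (x : EuclideanSpace ℝ (Fin 3)), x ∈ Q.motif →
        -c ≤ (2 : ℝ)⁻¹ *
          (∑' y : {y : EuclideanSpace ℝ (Fin 3) // y ∈ Q.points ∧ y ≠ x},
            (fun r => if r < ρ then lennardJones r - f r else 0) (dist x y.1)) + T Q x) ∧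
      c + f 0 / 2 = -(P₀.energyPerParticle lennardJones)) ↔
    ExactCertificate :=
  transferDesign_iff_coreDesign.trans coreDesign_iff_exactCertificate

/-- **Corollary: the content stub gives `KeplerBound`** (route item 11961 ↔ 0627, open) — the wall this
line shares with the three dead lines of the crux. [folklore] -/
theorem keplerBound_of_transferDesign
    (h : ∃ (P₀ : PeriodicConfiguration 3) (ρ c : ℝ) (f : ℝ → ℝ)
        (T : PeriodicConfiguration 3 → EuclideanSpace ℝ (Fin 3) → ℝ),
      (∀ (n : ℕ) (y : Fin n → EuclideanSpace ℝ (Fin 3)) (w : Fin n → ℝ),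
        0 ≤ ∑ i, ∑ j, w i * w j * f (dist (y i) (y j))) ∧
      (∀ r : ℝ, ρ ≤ r → 0 < r → f r ≤ lennardJones r) ∧
      (∀ Q : PeriodicConfiguration 3, ∑ x ∈ Q.motif, T Q x = 0) ∧
      (∀ (Q : PeriodicConfiguration 3) (x : EuclideanSpace ℝ (Fin 3)), x ∈ Q.motif →
        -c ≤ (2 : ℝ)⁻¹ *
          (∑' y : {y : EuclideanSpace ℝ (Fin 3) // y ∈ Q.points ∧ y ≠ x},
            (fun r => if r < ρ then lennardJones r - f r else 0) (dist x y.1)) + T Q x) ∧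
      c + f 0 / 2 = -(P₀.energyPerParticle lennardJones)) :
    KeplerBound :=
  keplerBound_of_coreDesign (transferDesign_iff_coreDesign.1 h)

end Summit.AtomisticToContinuum.Crystallization.Theorems.ThreeConeCertificateExactCertificate.Design

end
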